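import Summits.ResolutionOfSingularities.ResolutionOfSingularities.Theorems.EquisingularLiftEquisingularLiftResolveOnePointDimOne
import HarnessLib

/-!
# [OURS · L1 W4.5(b)] EL♮ first rung, part 1 — one-point resolution of a curve by ADMISSIBLE section blow-ups

Crux chain w45b, working crux `EquisingularLiftNat` (EL♮, item stmt-ResolutionOfSingularities-20038 of route `EquisingularLift`;
line `sections`, stub `stub_elnat_le_two`). NOT a statement of any manuscript; AI-written, weaker than expert review.
EL♮ differs from the typed door EL (stmt-15660) in two ways: the ambient is FIXED to `ℙⁿ_O`, and every blow-up step of the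
chain carries extra hypotheses tying the centre to the current strict transform (E1: the special-fibre points of the centre lie
in the current strict transform; in the working strengthening E2 also: the centre is `O`-smooth). The landed curve-case engine of
the door (`StrataSplit.resolveOnePoint_dimOne_dim`; Hensel SECTIONS through the non-regular points) already produces such centres,
but concludes with the E1-free chain. This file re-runs it with an ARBITRARY step-admissibility predicate `Adm X' σ' Y' C` threaded
through the recursor-encoded chain, under the single hypothesis that kernels of sections (closed immersions `s : Spec O → X'` with
`s ≫ σ' ≫ σ₁ ≫ q = 𝟙`) through a point of `Y'` are admissible: `admChain_chain` (admissible chains are chains), `admChain_comp`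
(`Split.Chain.comp` with `Adm` threaded), `resolveOnePoint_dimOne_adm` (`resolveOnePoint_dimOne_dim` with `Adm` threaded; verbatim
the landed proof, the one new line feeds `Adm` with the section through the bad point, which lies on the current strict transform).
Part 2 (`…EquisingularLiftNatLeTwo.lean`) instantiates `Adm := E1 ∧ E2` on `ℙⁿ_{𝕎(k)}` and proves EL♮(`n ≤ 2`).
-/

set_option linter.dupNamespace false -- mandated namespace `Summit.<Summit>.<Problem>` of this single-conjunct summit
set_option linter.overlappingInstances false -- signatures carry `[IsDomain O] [IsDiscreteValuationRing O]`

noncomputable section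

open CategoryTheory AlgebraicGeometry TopologicalSpace Topology
open Literature.AlgebraicGeometry.Resolution
open AlgebraicGeometry.Scheme.IdealSheafData
open Summit.ResolutionOfSingularities.ResolutionOfSingularities.Theses.EquisingularLift.Split
open Summit.ResolutionOfSingularities.ResolutionOfSingularities.Cruxes.EquisingularLift.StrataSplit

namespace Summit.ResolutionOfSingularities.ResolutionOfSingularities.Cruxes.EquisingularLiftNat.Sections

/-! ## Admissible chains -/

/-- An ADMISSIBLE chain (recursor-encoded chain of blow-ups in regular centres off the generic point of `Y`, each step
additionally satisfying `Adm`) is a chain. [folklore] -/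
theorem admChain_chain {P : Scheme.{0}} {Y : Set P}
    (Adm : ∀ X' : Scheme.{0}, (X' ⟶ P) → Set X' → X'.IdealSheafData → Prop)
    {P' : Scheme.{0}} {σ : P' ⟶ P} {S' : Set P'}
    (h : ∀ Q : (∀ X' : AlgebraicGeometry.Scheme.{0}, (X' ⟶ P) → Set X' → Prop),
      Q P (CategoryTheory.CategoryStruct.id P) Y →
      (∀ (X' X'' : AlgebraicGeometry.Scheme.{0}) (σ' : X' ⟶ P) (Y' : Set X') (C : X'.IdealSheafData)
        (τ : X'' ⟶ X'), Q X' σ' Y' → Literature.AlgebraicGeometry.Resolution.IsBlowup τ C →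
        Literature.AlgebraicGeometry.Resolution.Scheme.IsRegular C.subscheme →
        σ' '' (C.support : Set X') ⊆ {x : P | ¬ IsGenericPoint x Y} → Adm X' σ' Y' C →
        Q X'' (CategoryTheory.CategoryStruct.comp τ σ') (closure (τ ⁻¹' (Y' \ (C.support : Set X'))))) →
      Q P' σ S') :
    Chain P Y P' σ S' :=
  fun Q h0 hstep => h Q h0 (fun X' X'' σ' Y' C τ hQ hbl hC hgen _ => hstep X' X'' σ' Y' C τ hQ hbl hC hgen)

/-- COMPOSITION of admissible chains: an admissible chain over `(P, Y)` followed by an admissible chain over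
`(P₁, closure S₁)` (for the pulled-back admissibility predicate) is an admissible chain over `(P, Y)` — verbatim
`Split.Chain.comp` with `Adm` threaded. [folklore] -/
theorem admChain_comp {P : Scheme.{0}} {Y : Set P} {ξ : P} (hξ : IsGenericPoint ξ Y)
    (Adm : ∀ X' : Scheme.{0}, (X' ⟶ P) → Set X' → X'.IdealSheafData → Prop)
    {P₁ : Scheme.{0}} {σ₁ : P₁ ⟶ P} {S₁ : Set P₁}
    (h₁ : ∀ Q : (∀ X' : AlgebraicGeometry.Scheme.{0}, (X' ⟶ P) → Set X' → Prop),
      Q P (CategoryTheory.CategoryStruct.id P) Y →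
      (∀ (X' X'' : AlgebraicGeometry.Scheme.{0}) (σ' : X' ⟶ P) (Y' : Set X') (C : X'.IdealSheafData)
        (τ : X'' ⟶ X'), Q X' σ' Y' → Literature.AlgebraicGeometry.Resolution.IsBlowup τ C →
        Literature.AlgebraicGeometry.Resolution.Scheme.IsRegular C.subscheme →
        σ' '' (C.support : Set X') ⊆ {x : P | ¬ IsGenericPoint x Y} → Adm X' σ' Y' C →
        Q X'' (CategoryTheory.CategoryStruct.comp τ σ') (closure (τ ⁻¹' (Y' \ (C.support : Set X'))))) →
      Q P₁ σ₁ S₁)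
    {P₂ : Scheme.{0}} {σ₂ : P₂ ⟶ P₁} {S₂ : Set P₂}
    (h₂ : ∀ Q : (∀ X' : AlgebraicGeometry.Scheme.{0}, (X' ⟶ P₁) → Set X' → Prop),
      Q P₁ (CategoryTheory.CategoryStruct.id P₁) (closure S₁) →
      (∀ (X' X'' : AlgebraicGeometry.Scheme.{0}) (σ' : X' ⟶ P₁) (Y' : Set X') (C : X'.IdealSheafData)
        (τ : X'' ⟶ X'), Q X' σ' Y' → Literature.AlgebraicGeometry.Resolution.IsBlowup τ C →
        Literature.AlgebraicGeometry.Resolution.Scheme.IsRegular C.subscheme →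
        σ' '' (C.support : Set X') ⊆ {x : P₁ | ¬ IsGenericPoint x (closure S₁)} →
        Adm X' (CategoryTheory.CategoryStruct.comp σ' σ₁) Y' C →
        Q X'' (CategoryTheory.CategoryStruct.comp τ σ') (closure (τ ⁻¹' (Y' \ (C.support : Set X'))))) →
      Q P₂ σ₂ S₂) :
    ∀ Q : (∀ X' : AlgebraicGeometry.Scheme.{0}, (X' ⟶ P) → Set X' → Prop),
      Q P (CategoryTheory.CategoryStruct.id P) Y →
      (∀ (X' X'' : AlgebraicGeometry.Scheme.{0}) (σ' : X' ⟶ P) (Y' : Set X') (C : X'.IdealSheafData)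
        (τ : X'' ⟶ X'), Q X' σ' Y' → Literature.AlgebraicGeometry.Resolution.IsBlowup τ C →
        Literature.AlgebraicGeometry.Resolution.Scheme.IsRegular C.subscheme →
        σ' '' (C.support : Set X') ⊆ {x : P | ¬ IsGenericPoint x Y} → Adm X' σ' Y' C →
        Q X'' (CategoryTheory.CategoryStruct.comp τ σ') (closure (τ ⁻¹' (Y' \ (C.support : Set X'))))) →
      Q P₂ (CategoryTheory.CategoryStruct.comp σ₂ σ₁) S₂ := by
  obtain ⟨ξ₁, hfib, hS₁⟩ := (admChain_chain Adm h₁).fibre hξ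
  have hS₁cl : closure S₁ = S₁ := by rw [hS₁, closure_closure]
  have hgen₁ : IsGenericPoint ξ₁ (closure S₁) := by
    rw [isGenericPoint_def, hS₁, closure_closure]
  intro Q hbase hstep
  have hQ₁ : Q P₁ σ₁ S₁ := h₁ Q hbase hstep
  refine h₂ (fun X' τ T => Q X' (CategoryStruct.comp τ σ₁) T) ?_ ?_
  · simpa [hS₁cl] using hQ₁
  · intro X' X'' τ T C τ' hQ hτ' hC hTC hadm
    have key : (CategoryStruct.comp τ σ₁) '' (C.support : Set X') ⊆ {x : P | ¬ IsGenericPoint x Y} := by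
      rintro _ ⟨c, hc, rfl⟩ hgen
      have h1 : σ₁ (τ c) = ξ := by
        rw [← Scheme.Hom.comp_apply]
        exact hgen.eq hξ
      have h2 : τ c = ξ₁ := by
        have : τ c ∈ σ₁ ⁻¹' {ξ} := h1
        rw [hfib] at this; simpa using this
      exact hTC ⟨c, hc, rfl⟩ (h2 ▸ hgen₁)
    have := hstep X' X'' (CategoryStruct.comp τ σ₁) T C τ' hQ hτ' hC key hadm
    simpa [Category.assoc] using this

/-! ## One-point resolution of a curve by admissible section blow-ups -/

/-- **`resolveOnePoint_dimOne_dim` with step admissibility threaded.** Same hypotheses as the landed engine (complete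
characteristic-`0` DVR `O` with algebraically closed residue field, smooth proper ambient `q : P → Spec O`, irreducible closed
`Y` in the special fibre, a stage `(P₁, σ₁, S₁)` of a chain with irreducible special fibre, finitely many non-regular points of
the reduced strict transform `V(closure S₁)`, good reduction there, `dim ≤ 1`), plus a step-admissibility predicate `Adm` over
`P₁` for which KERNELS OF SECTIONS THROUGH A POINT OF THE CURRENT STRICT TRANSFORM are admissible. Conclusion: one
non-regular point `x₀` is resolved by a chain over `(P₁, closure S₁)` all of whose steps are admissible, with irreducible
special fibre, an isomorphism off `x₀`, `dim ≤ 1` again. Proof verbatim the landed one (sections through the bad points;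
induction on the total `δ`-invariant); the section `s` through the bad point `w₁ ∈ S'` is fed to `Adm`.
[folklore; Kollár 2007 §1.4, Liu 2002 §8.1] -/
theorem resolveOnePoint_dimOne_adm : ∀ (O : Type) [CommRing O] [IsDomain O] [IsDiscreteValuationRing O] [CharZero O] [IsAdicComplete (IsLocalRing.maximalIdeal O) O] [IsAlgClosed (IsLocalRing.ResidueField O)] (P P₁ : AlgebraicGeometry.Scheme.{0}) (q : P ⟶ AlgebraicGeometry.Spec (.of O)) (Y : TopologicalSpace.Closeds P) (σ₁ : P₁ ⟶ P) (S₁ : Set P₁), AlgebraicGeometry.Smooth q → AlgebraicGeometry.IsProper q → (Y : Set P) ⊆ q ⁻¹' {IsLocalRing.closedPoint O} → IsIrreducible (Y : Set P) → Chain P (Y : Set P) P₁ σ₁ S₁ → IsIrreducible (((CategoryTheory.CategoryStruct.comp σ₁ q)) ⁻¹' {IsLocalRing.closedPoint O}) → (singSet S₁).Finite → GoodSet ((CategoryTheory.CategoryStruct.comp σ₁ q)) S₁ → topologicalKrullDim ↥(AlgebraicGeometry.Scheme.IdealSheafData.vanishingIdeal (⟨closure S₁, isClosed_closure⟩ : TopologicalSpace.Closeds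 P₁)).subscheme ≤ 1 → ∀ (Adm : ∀ X' : AlgebraicGeometry.Scheme.{0}, (X' ⟶ P₁) → Set X' → X'.IdealSheafData → Prop), (∀ (X' : AlgebraicGeometry.Scheme.{0}) (σ' : X' ⟶ P₁) (Y' : Set X') (s : AlgebraicGeometry.Spec (.of O) ⟶ X'), AlgebraicGeometry.IsClosedImmersion s → CategoryTheory.CategoryStruct.comp s (CategoryTheory.CategoryStruct.comp σ' (CategoryTheory.CategoryStruct.comp σ₁ q)) = CategoryTheory.CategoryStruct.id _ → s (IsLocalRing.closedPoint O) ∈ Y' → Adm X' σ' Y' s.ker) → ∀ x₀ ∈ singSet S₁, ∃ (P₂ : AlgebraicGeometry.Scheme.{0}) (σ₂ : P₂ ⟶ P₁) (S₂ : Set P₂), topologicalKrullDim ↥(AlgebraicGeometry.Scheme.IdealSheafData.vanishingIdeal (⟨closure S₂, isClosed_closure⟩ : TopologicalSpace.Closeds P₂)).subscheme ≤ 1 ∧ (∀ Q : (∀ X' : AlgebraicGeometry.Scheme.{0}, (X' ⟶ P₁) → Set X' → Prop), Q P₁ (CategoryTheory.CategoryStruct.id P₁) (closure S₁) → (∀ (X'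 X'' : AlgebraicGeometry.Scheme.{0}) (σ' : X' ⟶ P₁) (Y' : Set X') (C : X'.IdealSheafData) (τ : X'' ⟶ X'), Q X' σ' Y' → Literature.AlgebraicGeometry.Resolution.IsBlowup τ C → Literature.AlgebraicGeometry.Resolution.Scheme.IsRegular C.subscheme → σ' '' (C.support : Set X') ⊆ {x : P₁ | ¬ IsGenericPoint x (closure S₁)} → Adm X' σ' Y' C → Q X'' (CategoryTheory.CategoryStruct.comp τ σ') (closure (τ ⁻¹' (Y' \ (C.support : Set X'))))) → Q P₂ σ₂ S₂) ∧ IsIrreducible (((CategoryTheory.CategoryStruct.comp (CategoryTheory.CategoryStruct.comp σ₂ σ₁) q)) ⁻¹' {IsLocalRing.closedPoint O}) ∧ ∃ V : P₁.Opens, (∀ x : ↥(AlgebraicGeometry.Scheme.IdealSheafData.vanishingIdeal (⟨closure S₁, isClosed_closure⟩ : TopologicalSpace.Closeds P₁)).subscheme, x ≠ x₀ → ((AlgebraicGeometry.Scheme.IdealSheafData.vanishingIdeal (⟨closure S₁, isClosed_closure⟩ : TopologicalSpace.Closeds P₁)).subschemeι x : P₁) ∈ V) ∧ CategoryTheory.IsIso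 (σ₂ ∣_ V) ∧ (∀ z : ↥(AlgebraicGeometry.Scheme.IdealSheafData.vanishingIdeal (⟨closure S₂, isClosed_closure⟩ : TopologicalSpace.Closeds P₂)).subscheme, (σ₂ ((AlgebraicGeometry.Scheme.IdealSheafData.vanishingIdeal (⟨closure S₂, isClosed_closure⟩ : TopologicalSpace.Closeds P₂)).subschemeι z) : P₁) = (AlgebraicGeometry.Scheme.IdealSheafData.vanishingIdeal (⟨closure S₁, isClosed_closure⟩ : TopologicalSpace.Closeds P₁)).subschemeι x₀ → IsRegularLocalRing ((AlgebraicGeometry.Scheme.IdealSheafData.vanishingIdeal (⟨closure S₂, isClosed_closure⟩ : TopologicalSpace.Closeds P₂)).subscheme.presheaf.stalk z)) := by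
  classical
  intro O _ _ _ _ _ _ P P₁ q Y σ₁ S₁ hq hqp hY hYirr hch₁ hirr₁ _ hgood₁ hdim Adm hAdm x₀ hx₀
  -- ambient facts
  haveI := hq
  haveI := hqp
  have hPnoeth : IsLocallyNoetherian P := LocallyOfFiniteType.isLocallyNoetherian q
  have hPreg : Scheme.IsRegular P := fun x => (stub_goodAtOfSmooth O P q hq x).1
  obtain ⟨hP₁noeth, hP₁reg, hσ₁⟩ := chain_isRegular P (Y : Set P) P₁ σ₁ S₁ hch₁ hPnoeth hPreg
  haveI := hP₁noeth
  haveI := hσ₁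
  set r₁ : P₁ ⟶ Spec (.of O) := σ₁ ≫ q with hr₁
  haveI : IsProper r₁ := inferInstance
  set s₀ := IsLocalRing.closedPoint O with hs₀def
  -- the closed irreducible set `closure S₁` and its reduced subscheme `Γ₁`
  have hTsub : closure S₁ ⊆ r₁ ⁻¹' {s₀} := closure_subset_preimage_of_chain q hYirr Y.isClosed hY hch₁
  obtain ⟨ξ, hξ⟩ : ∃ ξ : P, IsGenericPoint ξ (Y : Set P) := QuasiSober.sober hYirr Y.isClosed
  obtain ⟨ξ₁, -, hS₁⟩ := Chain.fibre hch₁ hξ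
  have hTirr : IsIrreducible (closure S₁) := by rw [hS₁, closure_closure]; exact isIrreducible_singleton.closure
  have hclS₁ : closure S₁ = S₁ := by rw [hS₁, closure_closure]
  haveI hΓ₁int : IsIntegral (vanishingIdeal (⟨closure S₁, isClosed_closure⟩ : Closeds P₁)).subscheme :=
    ComponentGluing.isIntegral_subscheme_vanishingIdeal _ hTirr
  obtain ⟨p₀, hp₀⟩ : ∃ p₀ : P₁, p₀ = (vanishingIdeal (⟨closure S₁, isClosed_closure⟩ : Closeds P₁)).subschemeι x₀ :=
    ⟨_, rfl⟩
  have hrange₁ : Set.range (vanishingIdeal (⟨closure S₁, isClosed_closure⟩ : Closeds P₁)).subschemeι = closure S₁ := by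
    rw [range_subschemeι, coe_support_vanishingIdeal]; rfl
  have hp₀T : p₀ ∈ closure S₁ := by rw [hp₀]; exact (Set.ext_iff.mp hrange₁ _).mp (Set.mem_range_self x₀)
  have hp₀s : r₁ p₀ = s₀ := hTsub hp₀T
  have hp₀gen : ¬ IsGenericPoint p₀ (closure S₁) := by
    rw [hp₀]
    exact not_isGenericPoint_of_not_isRegularLocalRing (⟨closure S₁, isClosed_closure⟩ : Closeds P₁) hTirr x₀ hx₀
  -- THE INDUCTION on the total `δ`-invariant of the current reduced strict transform (admissible chains carried along)
  suffices key : ∀ (n : ℕ∞) (X' : Scheme.{0}) (σ' : X' ⟶ P₁) (S' : Set X')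
      [IsIntegral (vanishingIdeal (⟨closure S', isClosed_closure⟩ : Closeds X')).subscheme],
      (∀ Q : (∀ X' : AlgebraicGeometry.Scheme.{0}, (X' ⟶ P₁) → Set X' → Prop),
        Q P₁ (CategoryTheory.CategoryStruct.id P₁) (closure S₁) →
        (∀ (X' X'' : AlgebraicGeometry.Scheme.{0}) (σ' : X' ⟶ P₁) (Y' : Set X') (C : X'.IdealSheafData)
          (τ : X'' ⟶ X'), Q X' σ' Y' → Literature.AlgebraicGeometry.Resolution.IsBlowup τ C →
          Literature.AlgebraicGeometry.Resolution.Scheme.IsRegular C.subscheme →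
          σ' '' (C.support : Set X') ⊆ {x : P₁ | ¬ IsGenericPoint x (closure S₁)} → Adm X' σ' Y' C →
          Q X'' (CategoryTheory.CategoryStruct.comp τ σ') (closure (τ ⁻¹' (Y' \ (C.support : Set X'))))) →
        Q X' σ' S') →
      IsIrreducible ((σ' ≫ r₁) ⁻¹' {s₀}) →
      (∃ V : P₁.Opens, (∀ x : ↥(vanishingIdeal (⟨closure S₁, isClosed_closure⟩ : Closeds P₁)).subscheme, x ≠ x₀ →
          ((vanishingIdeal (⟨closure S₁, isClosed_closure⟩ : Closeds P₁)).subschemeι x : P₁) ∈ V) ∧ IsIso (σ' ∣_ V)) →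
      (∀ w : X', σ' w = p₀ → GoodAt (σ' ≫ r₁) w) →
      topologicalKrullDim ↥(vanishingIdeal (⟨closure S', isClosed_closure⟩ : Closeds X')).subscheme ≤ 1 →
      ∑ᶠ y : ↥(vanishingIdeal (⟨closure S', isClosed_closure⟩ : Closeds X')).subscheme,
        pointDelta (vanishingIdeal (⟨closure S', isClosed_closure⟩ : Closeds X')).subscheme y = n →
      ∃ (P₂ : Scheme.{0}) (σ₂ : P₂ ⟶ P₁) (S₂ : Set P₂),
        topologicalKrullDim ↥(vanishingIdeal (⟨closure S₂, isClosed_closure⟩ : Closeds P₂)).subscheme ≤ 1 ∧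
        (∀ Q : (∀ X' : AlgebraicGeometry.Scheme.{0}, (X' ⟶ P₁) → Set X' → Prop),
          Q P₁ (CategoryTheory.CategoryStruct.id P₁) (closure S₁) →
          (∀ (X' X'' : AlgebraicGeometry.Scheme.{0}) (σ' : X' ⟶ P₁) (Y' : Set X') (C : X'.IdealSheafData)
            (τ : X'' ⟶ X'), Q X' σ' Y' → Literature.AlgebraicGeometry.Resolution.IsBlowup τ C →
            Literature.AlgebraicGeometry.Resolution.Scheme.IsRegular C.subscheme →
            σ' '' (C.support : Set X') ⊆ {x : P₁ | ¬ IsGenericPoint x (closure S₁)} → Adm X' σ' Y' C →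
            Q X'' (CategoryTheory.CategoryStruct.comp τ σ') (closure (τ ⁻¹' (Y' \ (C.support : Set X'))))) →
          Q P₂ σ₂ S₂) ∧
        IsIrreducible (((σ₂ ≫ σ₁) ≫ q) ⁻¹' {s₀}) ∧
        ∃ V : P₁.Opens, (∀ x : ↥(vanishingIdeal (⟨closure S₁, isClosed_closure⟩ : Closeds P₁)).subscheme, x ≠ x₀ →
          ((vanishingIdeal (⟨closure S₁, isClosed_closure⟩ : Closeds P₁)).subschemeι x : P₁) ∈ V) ∧ IsIso (σ₂ ∣_ V) ∧
          ∀ z : ↥(vanishingIdeal (⟨closure S₂, isClosed_closure⟩ : Closeds P₂)).subscheme,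
            (σ₂ ((vanishingIdeal (⟨closure S₂, isClosed_closure⟩ : Closeds P₂)).subschemeι z) : P₁) = p₀ →
            IsRegularLocalRing ((vanishingIdeal (⟨closure S₂, isClosed_closure⟩ : Closeds P₂)).subscheme.presheaf.stalk z) by
    -- the base stage `(P₁, 𝟙, S₁)`
    have hbase := key _ P₁ (𝟙 P₁) S₁ (fun Q h0 _ => by rwa [hclS₁] at h0)
      (by simpa only [Category.id_comp] using hirr₁)
      ⟨⊤, fun x _ => trivial, inferInstance⟩
      (fun w hw => by
        have hw' : w = p₀ := by simpa using hw
        rw [Category.id_comp, hw', hp₀]; exact hgood₁ x₀ hx₀) hdim rfl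
    simpa only [hp₀] using hbase
  intro n
  induction n using WellFoundedLT.induction with
  | ind n ih =>
  intro X' σ' S' hI' hchain hirr hV hgoodAt hdim' hM
  -- the underlying (admissibility-free) chain of the stage
  have hchainC : Chain P₁ (closure S₁) X' σ' S' := fun Q h0 hstep =>
    hchain Q h0 (fun X₁ X₂ σ₀ Y₀ C τ hQ hbl hC hgen _ => hstep X₁ X₂ σ₀ Y₀ C τ hQ hbl hC hgen)
  -- facts about the stage
  obtain ⟨hnoeth', hreg', hpropσ'⟩ := chain_isRegular P₁ (closure S₁) X' σ' S' hchainC hP₁noeth hP₁reg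
  haveI := hnoeth'
  haveI := hpropσ'
  set r' : X' ⟶ Spec (.of O) := σ' ≫ r₁ with hr'
  haveI : IsProper r' := inferInstance
  by_cases hbad : ∃ z : ↥(vanishingIdeal (⟨closure S', isClosed_closure⟩ : Closeds X')).subscheme,
      σ' ((vanishingIdeal (⟨closure S', isClosed_closure⟩ : Closeds X')).subschemeι z) = p₀ ∧
      ¬ IsRegularLocalRing ((vanishingIdeal (⟨closure S', isClosed_closure⟩ : Closeds X')).subscheme.presheaf.stalk z)
  swap
  · -- EXIT: no non-regular point over `x₀` is left
    obtain ⟨V, hVx, hiso⟩ := hV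
    refine ⟨X', σ', S', hdim', hchain, by simpa only [Category.assoc] using hirr, V, hVx, hiso, fun z hz => ?_⟩
    by_contra h
    exact hbad ⟨z, hz, h⟩
  -- STEP: blow up a section through a non-regular point `z₁` over `x₀`
  obtain ⟨z₁, hz₁, hz₁reg⟩ := hbad
  obtain ⟨V, hVx, hiso⟩ := hV
  -- (s1) the stage is integral and flat over `O`
  set w₁ : X' := (vanishingIdeal (⟨closure S', isClosed_closure⟩ : Closeds X')).subschemeι z₁ with hw₁
  have hr'w₁ : r' w₁ = s₀ := by
    show (σ' ≫ r₁) w₁ = s₀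
    rw [Scheme.Hom.comp_apply, hz₁, hp₀s]
  have hga : GoodAt r' w₁ := hgoodAt w₁ hz₁
  obtain ⟨hint', hflat', -⟩ := isIntegral_and_flat_of_goodAt O X' r' hnoeth' hreg' hirr ⟨w₁, hr'w₁, hga⟩
  haveI := hint'
  -- (s2) a smooth neighbourhood of `w₁`
  haveI : LocallyOfFinitePresentation r' := locallyOfFinitePresentation_of_isLocallyNoetherian' r'
  obtain ⟨U, hw₁U, hU⟩ := exists_smooth_nhd_of_goodAt O X' r' inferInstance hflat' w₁ hr'w₁ hga
  -- (s3) `S'` is closed irreducible inside the special fibre; `w₁` is a closed point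
  obtain ⟨ξT, hξT⟩ : ∃ ξT : P₁, IsGenericPoint ξT (closure S₁) := QuasiSober.sober hTirr isClosed_closure
  obtain ⟨ξ', hfib', hS'⟩ := Chain.fibre hchainC hξT
  have hS'cl : IsClosed S' := by rw [hS']; exact isClosed_closure
  have hclS' : closure S' = S' := hS'cl.closure_eq
  have hS'irr : IsIrreducible (closure S') := by rw [hS', closure_closure]; exact isIrreducible_singleton.closure
  have hS'sub : closure S' ⊆ r' ⁻¹' {s₀} :=
    closure_subset_preimage_of_chain r₁ hTirr isClosed_closure hTsub hchainC
  have hrange' : Set.range (vanishingIdeal (⟨closure S', isClosed_closure⟩ : Closeds X')).subschemeι = closure S' := by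
    rw [range_subschemeι, coe_support_vanishingIdeal]; rfl
  have hw₁gen : ¬ IsGenericPoint w₁ (closure S') :=
    not_isGenericPoint_of_not_isRegularLocalRing (⟨closure S', isClosed_closure⟩ : Closeds X') hS'irr z₁ hz₁reg
  have hw₁S' : w₁ ∈ S' := by
    rw [← hclS']
    exact (Set.ext_iff.mp hrange' _).mp (Set.mem_range_self z₁)
  haveI : CompactSpace X' := QuasiCompact.compactSpace_of_compactSpace r'
  haveI : IsNoetherian X' := ⟨⟩
  haveI : IsNoetherian (vanishingIdeal (⟨closure S', isClosed_closure⟩ : Closeds X')).subscheme :=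
    isNoetherian_of_isClosedImmersion (vanishingIdeal (⟨closure S', isClosed_closure⟩ : Closeds X')).subschemeι
  have hqe' : Scheme.IsQuasiExcellent (vanishingIdeal (⟨closure S', isClosed_closure⟩ : Closeds X')).subscheme := by
    haveI : IsReduced (vanishingIdeal (⟨closure S', isClosed_closure⟩ : Closeds X')).subscheme := inferInstance
    refine isQuasiExcellent_of_range_subset_closedPoint
      ((vanishingIdeal (⟨closure S', isClosed_closure⟩ : Closeds X')).subschemeι ≫ r') ?_
    rintro _ ⟨y, rfl⟩
    rw [Scheme.Hom.comp_apply]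
    exact hS'sub ((Set.ext_iff.mp hrange' _).mp (Set.mem_range_self y))
  have hz₁cl : IsClosed ({z₁} : Set (vanishingIdeal (⟨closure S', isClosed_closure⟩ : Closeds X')).subscheme) :=
    isClosed_singleton_of_not_isRegularLocalRing hqe' hdim' z₁ hz₁reg
  have hw₁cl : IsClosed ({w₁} : Set X') := by
    have h := (vanishingIdeal (⟨closure S', isClosed_closure⟩ : Closeds X')).subschemeι.isClosedEmbedding.isClosedMap
      _ hz₁cl
    rwa [Set.image_singleton] at h
  -- (s4) a `κ`-point at `w₁` and a section through it (Hensel)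
  obtain ⟨xpt, hxr, hxrange⟩ := exists_point_of_isClosed O X' r' inferInstance w₁ hw₁cl hr'w₁
  obtain ⟨s, hs, hsx⟩ := exists_section_of_smooth O X' r' U hU xpt
    (by rw [hxrange]; exact Set.singleton_subset_iff.mpr hw₁U) hxr
  have hs₀ : s s₀ = w₁ := by
    haveI : IsLocalHom (CommRingCat.ofHom (IsLocalRing.residue O)).hom :=
      inferInstanceAs (IsLocalHom (IsLocalRing.residue O))
    have h1 : Spec.map (CommRingCat.ofHom (IsLocalRing.residue O))
        (IsLocalRing.closedPoint (IsLocalRing.ResidueField O)) = s₀ := AlgebraicGeometry.Spec_closedPoint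
    have h2 : s s₀ = xpt (IsLocalRing.closedPoint (IsLocalRing.ResidueField O)) := by
      rw [← h1, ← Scheme.Hom.comp_apply, hsx]
    rw [h2]
    exact (Set.ext_iff.mp hxrange _).mp (Set.mem_range_self _)
  have hsU : s s₀ ∈ U := hs₀ ▸ hw₁U
  -- points of the section: `r' (s t) = t`
  have hrs : ∀ t : Spec (.of O), r' (s t) = t := fun t => by
    rw [← Scheme.Hom.comp_apply, hs]; rfl
  -- (s5) the centre `C = s.ker`; it is ADMISSIBLE (section through `w₁ ∈ S'`)
  obtain ⟨hsci, hCreg, -, hCsupp⟩ := section_isClosedImmersion_and_isRegular_ker O X' r' s hs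
  have hadm : Adm X' σ' S' s.ker := hAdm X' σ' S' s hsci hs (hs₀ ▸ hw₁S')
  have hCspecial : ∀ c ∈ (s.ker.support : Set X'), r' c = s₀ → c = w₁ := by
    intro c hc hcs
    rw [hCsupp] at hc
    obtain ⟨t, rfl⟩ := hc
    rw [hrs] at hcs
    rw [hcs, hs₀]
  have hξ'mem : ξ' ∈ closure S' := by rw [hS', closure_closure]; exact subset_closure rfl
  have hξ'gen : IsGenericPoint ξ' (closure S') := by
    rw [isGenericPoint_def, hS', closure_closure]
  have hξ'C : ξ' ∉ (s.ker.support : Set X') := fun h =>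
    hw₁gen (hCspecial ξ' h (hS'sub hξ'mem) ▸ hξ'gen)
  have hCne : s.ker ≠ ⊥ := by
    intro h; apply hξ'C; rw [h, Scheme.IdealSheafData.support_bot]; trivial
  have hnotsub : ¬ closure S' ⊆ (s.ker.support : Set X') := fun h => hξ'C (h hξ'mem)
  -- (s6) blow up
  obtain ⟨X'', τ, hτ⟩ := exists_isBlowup X' s.ker
  haveI : IsProper τ := hτ.isProper
  have hnoeth'' : IsLocallyNoetherian X'' := LocallyOfFiniteType.isLocallyNoetherian τ
  -- (s7) the extended ADMISSIBLE chain
  have hT : σ' '' (s.ker.support : Set X') ⊆ {x : P₁ | ¬ IsGenericPoint x (closure S₁)} := by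
    rintro _ ⟨c, hc, rfl⟩ hgen
    have hcs : r' c = s₀ := by
      show (σ' ≫ r₁) c = s₀
      rw [Scheme.Hom.comp_apply]
      exact hTsub hgen.mem
    have hc' := hCspecial c hc hcs
    rw [hc', hz₁] at hgen
    exact hp₀gen hgen
  have hchain'' : ∀ Q : (∀ X' : AlgebraicGeometry.Scheme.{0}, (X' ⟶ P₁) → Set X' → Prop),
      Q P₁ (CategoryTheory.CategoryStruct.id P₁) (closure S₁) →
      (∀ (X' X'' : AlgebraicGeometry.Scheme.{0}) (σ' : X' ⟶ P₁) (Y' : Set X') (C : X'.IdealSheafData)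
        (τ : X'' ⟶ X'), Q X' σ' Y' → Literature.AlgebraicGeometry.Resolution.IsBlowup τ C →
        Literature.AlgebraicGeometry.Resolution.Scheme.IsRegular C.subscheme →
        σ' '' (C.support : Set X') ⊆ {x : P₁ | ¬ IsGenericPoint x (closure S₁)} → Adm X' σ' Y' C →
        Q X'' (CategoryTheory.CategoryStruct.comp τ σ') (closure (τ ⁻¹' (Y' \ (C.support : Set X'))))) →
      Q X'' (τ ≫ σ') (closure (τ ⁻¹' (S' \ (s.ker.support : Set X')))) :=
    fun Q h0 hstep => hstep X' X'' σ' S' s.ker τ (hchain Q h0 hstep) hτ hCreg hT hadm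
  have hchain''C : Chain P₁ (closure S₁) X'' (τ ≫ σ') (closure (τ ⁻¹' (S' \ (s.ker.support : Set X')))) :=
    fun Q h0 hstep => hchain'' Q h0 (fun X₁ X₂ σ₀ Y₀ C τ₀ hQ hbl hC hgen _ => hstep X₁ X₂ σ₀ Y₀ C τ₀ hQ hbl hC hgen)
  -- (s8) the special fibre stays irreducible
  have hirr'' : IsIrreducible (((τ ≫ σ') ≫ r₁) ⁻¹' {s₀}) := by
    rw [Category.assoc]
    exact isIrreducible_specialFibre_of_isBlowup_section O X' X'' r' U hU s hs hsU hCne τ hτ hirr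
  -- (s9) the open `V''` over which the new chain is an isomorphism
  have hclosed : IsClosed (σ' '' (s.ker.support : Set X')) := σ'.isClosedMap _ s.ker.support.isClosed
  let V'' : P₁.Opens := V ⊓ ⟨(σ' '' (s.ker.support : Set X'))ᶜ, hclosed.isOpen_compl⟩
  have hV''V : V'' ≤ V := inf_le_left
  have hV''x : ∀ x : ↥(vanishingIdeal (⟨closure S₁, isClosed_closure⟩ : Closeds P₁)).subscheme, x ≠ x₀ →
      ((vanishingIdeal (⟨closure S₁, isClosed_closure⟩ : Closeds P₁)).subschemeι x : P₁) ∈ V'' := by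
    intro x hx
    refine ⟨hVx x hx, ?_⟩
    rintro ⟨c, hc, hce⟩
    have hxT : ((vanishingIdeal (⟨closure S₁, isClosed_closure⟩ : Closeds P₁)).subschemeι x : P₁) ∈ closure S₁ :=
      (Set.ext_iff.mp hrange₁ _).mp (Set.mem_range_self x)
    have hcs : r' c = s₀ := by
      show (σ' ≫ r₁) c = s₀
      rw [Scheme.Hom.comp_apply, hce]
      exact hTsub hxT
    have hc' := hCspecial c hc hcs
    rw [hc', hz₁, hp₀] at hce
    exact hx ((vanishingIdeal (⟨closure S₁, isClosed_closure⟩ : Closeds P₁)).subschemeι.isClosedEmbedding.injective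
      hce).symm
  let Wc : X'.Opens := ⟨(s.ker.support : Set X')ᶜ, s.ker.support.isClosed.isOpen_compl⟩
  have hWc : IsIso (τ ∣_ Wc) := hτ.isIso_morphismRestrict disjoint_compl_left
  have hle : (Opens.map σ'.base).obj V'' ≤ Wc := fun x hx hxC => hx.2 ⟨x, hxC, rfl⟩
  have hiso'' : IsIso ((τ ≫ σ') ∣_ V'') := by
    rw [morphismRestrict_comp]
    have i1 := isIso_morphismRestrict_of_le σ' hiso hV''V
    have i2 := isIso_morphismRestrict_of_le τ hWc hle
    exact @IsIso.comp_isIso _ _ _ _ _ _ _ i2 i1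
  -- (s10) good reduction at every point over `x₀`
  have hgoodAt'' : ∀ w : X'', (τ ≫ σ') w = p₀ → GoodAt ((τ ≫ σ') ≫ r₁) w := by
    intro w hw
    rw [Scheme.Hom.comp_apply] at hw
    rw [Category.assoc]
    by_cases hC : τ w ∈ (s.ker.support : Set X')
    · have hcs : r' (τ w) = s₀ := by
        show (σ' ≫ r₁) (τ w) = s₀
        rw [Scheme.Hom.comp_apply, hw, hp₀s]
      have hc' : τ w = s s₀ := (hCspecial _ hC hcs).trans hs₀.symm
      exact goodAt_of_isBlowup_section O X' X'' r' U hU s hs hsU τ hτ w hc'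
    · exact (stub_goodAtOverIso X' X'' τ Wc hWc w (τ w) rfl hC O r').mpr (hgoodAt (τ w) hw)
  -- (s11) the new reduced strict transform is the point blow-up of the curve: `dim ≤ 1` and the total `δ` drops
  set S'' : Set X'' := closure (τ ⁻¹' (S' \ (s.ker.support : Set X'))) with hS''def
  obtain ⟨ξ'', -, hS''⟩ := Chain.fibre hchain''C hξT
  have hS''cl : closure S'' = S'' := by rw [hS'', closure_closure]
  have hS''irr : IsIrreducible (closure S'') := by rw [hS'', closure_closure]; exact isIrreducible_singleton.closure
  haveI hI'' : IsIntegral (vanishingIdeal (⟨closure S'', isClosed_closure⟩ : Closeds X'')).subscheme :=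
    ComponentGluing.isIntegral_subscheme_vanishingIdeal _ hS''irr
  have e1 : closure (τ ⁻¹' (closure S' \ (s.ker.support : Set X'))) = closure S'' := by
    rw [hclS', hS''cl]
  have e2 : (⟨closure (τ ⁻¹' (closure S' \ (s.ker.support : Set X'))), isClosed_closure⟩ : Closeds X'') =
      ⟨closure S'', isClosed_closure⟩ := TopologicalSpace.Closeds.ext e1
  have L : ∀ [IsIntegral (vanishingIdeal (⟨closure (τ ⁻¹' (closure S' \ (s.ker.support : Set X'))),
      isClosed_closure⟩ : Closeds X'')).subscheme],
      topologicalKrullDim ↥(vanishingIdeal (⟨closure (τ ⁻¹' (closure S' \ (s.ker.support : Set X'))),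
        isClosed_closure⟩ : Closeds X'')).subscheme ≤ 1 ∧
      ∑ᶠ y : ↥(vanishingIdeal (⟨closure (τ ⁻¹' (closure S' \ (s.ker.support : Set X'))),
          isClosed_closure⟩ : Closeds X'')).subscheme,
        pointDelta (vanishingIdeal (⟨closure (τ ⁻¹' (closure S' \ (s.ker.support : Set X'))),
          isClosed_closure⟩ : Closeds X'')).subscheme y <
      ∑ᶠ y : ↥(vanishingIdeal (⟨closure S', isClosed_closure⟩ : Closeds X')).subscheme,
        pointDelta (vanishingIdeal (⟨closure S', isClosed_closure⟩ : Closeds X')).subscheme y := by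
    intro hinst
    have h := curveBlowup_of_isBlowup_section O X' X'' r' s hs τ hτ (closure S') isClosed_closure hS'irr hS'sub
      hnotsub z₁ hs₀.symm hz₁reg hdim'
    exact ⟨h.1, h.2.2.2.2.2⟩
  rw [e2] at L
  obtain ⟨hdim'', hlt⟩ := L
  -- (s12) induction hypothesis
  rw [hM] at hlt
  exact ih _ hlt X'' (τ ≫ σ') S'' hchain'' hirr'' ⟨V'', hV''x, hiso''⟩ hgoodAt'' hdim'' rfl

end Summit.ResolutionOfSingularities.ResolutionOfSingularities.Cruxes.EquisingularLiftNat.Sections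

end
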